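/-
Copyright (c) 2026. All rights reserved.
Released under Apache 2.0 license as described in the file LICENSE.
-/
import Summits.Langlands.Langlands.Theorems.SoloInformedRepairD2CrisKzeroAction
import HarnessLib

/-!
# `D(𝟙_m) = E^m ⊗ B^Γ`: invariants of the trivial representation (solo programme, rung Λ8a)

Programme `solo-Langlands-informed`, repair of the crystalline clause D2-cris of `Summit.Langlands`.
The clause `CrystallineCompatibleAt` (`Theorems/SoloInformedRepairD2Cris`) predicts for the TRIVIAL local
representation `𝟙_m` that `D_cris(𝟙_m) = (ℚ̄_p^m ⊗_{ℚ_p} B_max(F))^{Γ_F}` has `ℚ̄_p`-dimension `m · f(F|ℚ_p)`.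
The tree proves the lower bound `m · f ≤ dim` (`D2Cris.mul_le_finrank_Dcris_one`) ASSUMING
`[Module.Finite ℚ̄_p (D_cris 𝟙_m)]`.  This file is the pure-algebra half of the missing finiteness and upper
bound: for any field `E ⊇ ℚ_p`, any commutative `ℚ_p`-algebra `B` with a family `Γ → (B →ₐ[ℚ_p] B)` and the
trivial `ρ`,

* §1 (over any field `K`, any `K`-vector space `V`) `mem_span_tmul_of_forall_lTensor_eq` ★ :
  **`(V ⊗_K N)^{1 ⊗ Γ} ⊆ V ⊗_K N^Γ`** — coordinates in a `K`-basis of `V` (`coord : V ⊗_K N ≃ (ι →₀ N)`,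
  natural in `N`: `coord_lTensor`), invariance read coordinatewise;
* §2 `invariants_eq_span_of_trivial` : **`D(𝟙_m) = (E^m ⊗_{ℚ_p} B)^Γ` is the `E`-span of the pure tensors
  `e_k ⊗ w`, `w ∈ B^Γ`** (`B^Γ = fixedSubalgebra`, tree); with a `ℚ_p`-basis `(w_j)` of a finite-dimensional
  `B^Γ` the `e_k ⊗ w_j` form an `E`-basis (`invariantsBasisOfTrivial`; independence is the tree's
  `linearIndependent_single_tmul`), so ★ `finite_invariants_of_trivial`, ★ `finrank_invariants_of_trivial` :
  **`dim_E D(𝟙_m) = m · dim_{ℚ_p} B^Γ`**;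
* §3 `B = B_max(F)`: `finite_Dcris_one`, `finrank_Dcris_one_eq` (**`dim_{ℚ̄_p} D_cris(𝟙_m) = m · dim_{ℚ_p}
  B_max(F)^{Γ_F}`** whenever the latter is finite) and `le_finrank_fixedSubalgebra` (**`f ≤ dim_{ℚ_p}
  B_max(F)^{Γ_F}`**, the Teichmüller periods `teichPeriod`, tree).

The remaining input — `dim_{ℚ_p} B_max(F)^{Γ_F} ≤ [F : ℚ_p]`, from `B_max(F)^{Γ_F} ↪ F` (rung Λ4) — is the
sequel `SoloInformedDcrisTrivialRank`.

References: Fontaine, Astérisque 223 (1994), Exp. III §1.3–§1.5 (`D_B(V) = (B ⊗ V)^{G_K}`, `dim ≤`);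
Buzzard–Gee, LMS LNS 414 (2014), Conj. 3.2.2.
-/

noncomputable section

open scoped MatrixGroups TensorProduct ValuativeRel Classical
open Field WittVector ValuativeRel
open Literature.NumberTheory.GaloisRepresentations Literature.NumberTheory.PAdicHodge
open Literature.NumberTheory.GaloisRepresentations.IsNonarchimedeanLocalField

namespace Summit.Langlands.Langlands.Theorems

namespace D2Cris

/-! ### §1 `(V ⊗_K N)^{1 ⊗ Γ} ⊆ V ⊗_K N^Γ` for a vector space `V` over a field `K` -/

section Coordinates

variable {K : Type*} [Field K] {V : Type*} [AddCommGroup V] [Module K V] {ι : Type*}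
  {N N' : Type*} [AddCommGroup N] [Module K N] [AddCommGroup N'] [Module K N']

variable (N) in
/-- **Coordinates of `V ⊗_K N` in a `K`-basis `b` of `V`**: `V ⊗_K N ≃ (ι →₀ N)`, `b i ⊗ n ↦ δ_i · n`.
[folklore] -/
def coord (b : Module.Basis ι K V) : V ⊗[K] N ≃ₗ[K] (ι →₀ N) :=
  (TensorProduct.congr b.repr (LinearEquiv.refl K N)) ≪≫ₗ TensorProduct.finsuppScalarLeft K N ι

/-- `coord⁻¹ (δ_i · n) = b i ⊗ n`. [folklore] -/
theorem coord_symm_single (b : Module.Basis ι K V) (i : ι) (n : N) :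
    (coord N b).symm (Finsupp.single i n) = b i ⊗ₜ[K] n := by
  rw [coord, LinearEquiv.trans_symm, LinearEquiv.trans_apply, TensorProduct.finsuppScalarLeft_symm_apply_single,
    TensorProduct.congr_symm_tmul, LinearEquiv.refl_symm, LinearEquiv.refl_apply, Module.Basis.repr_symm_single_one]

/-- `coord (b i ⊗ n) = δ_i · n`. [folklore] -/
theorem coord_tmul_basis (b : Module.Basis ι K V) (i : ι) (n : N) :
    coord N b (b i ⊗ₜ[K] n) = Finsupp.single i n := by
  rw [← coord_symm_single, LinearEquiv.apply_symm_apply]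

/-- **Naturality of the coordinates**: `coord ((1 ⊗ g) x) = g ∘ coord x` for a `K`-linear `g : N → N'`.
[folklore] -/
theorem coord_lTensor (b : Module.Basis ι K V) (g : N →ₗ[K] N') (x : V ⊗[K] N) :
    coord N' b (g.lTensor V x) = Finsupp.mapRange g (map_zero g) (coord N b x) := by
  have h : (coord N' b).toLinearMap ∘ₗ g.lTensor V ∘ₗ (coord N b).symm.toLinearMap = Finsupp.mapRange.linearMap g := by
    refine Finsupp.lhom_ext fun i n => ?_
    simp only [LinearMap.comp_apply, LinearEquiv.coe_toLinearMap, coord_symm_single, LinearMap.lTensor_tmul,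
      coord_tmul_basis, Finsupp.mapRange.linearMap_apply, Finsupp.mapRange_single]
  have h2 := LinearMap.congr_fun h (coord N b x)
  simpa only [LinearMap.comp_apply, LinearEquiv.coe_toLinearMap, LinearEquiv.symm_apply_apply,
    Finsupp.mapRange.linearMap_apply] using h2

/-- ★ **`(V ⊗_K N)^{1 ⊗ Γ} ⊆ V ⊗_K N^Γ`**: an element of `V ⊗_K N` fixed by `1 ⊗ g_σ` for every `σ` is a
`K`-linear combination of pure tensors `v ⊗ n` with `n` fixed by every `g_σ` (every coordinate of `x` in a
`K`-basis of `V` is fixed).  `W` is any set containing the common fixed points. [cite: FontaineAsterisque223III, Exp. III §1.5] -/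
theorem mem_span_tmul_of_forall_lTensor_eq {Γ : Type*} (g : Γ → (N →ₗ[K] N)) (W : Set N)
    (hW : ∀ n : N, (∀ σ, g σ n = n) → n ∈ W) {x : V ⊗[K] N} (hx : ∀ σ, (g σ).lTensor V x = x) :
    x ∈ Submodule.span K (Set.range fun vn : V × W => vn.1 ⊗ₜ[K] (vn.2 : N)) := by
  let b := Module.Basis.ofVectorSpace K V
  obtain ⟨c, hc⟩ : ∃ c, coord N b x = c := ⟨_, rfl⟩
  have hcW : ∀ i, c i ∈ W := fun i => hW _ fun σ => by
    have h := congrArg (fun y : Module.Basis.ofVectorSpaceIndex K V →₀ N => y i) (coord_lTensor b (g σ) x)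
    simp only [hx σ, hc, Finsupp.mapRange_apply] at h
    exact h.symm
  have hx' : x = c.sum fun i n => b i ⊗ₜ[K] n :=
    calc x = (coord N b).symm c := by rw [← hc, LinearEquiv.symm_apply_apply]
      _ = (coord N b).symm (c.sum Finsupp.single) := by rw [Finsupp.sum_single]
      _ = c.sum fun i n => (coord N b).symm (Finsupp.single i n) := map_finsuppSum _ _ _
      _ = c.sum fun i n => b i ⊗ₜ[K] n := by simp only [coord_symm_single]
  rw [hx', Finsupp.sum]
  exact Submodule.sum_mem _ fun i _ => Submodule.subset_span ⟨(b i, ⟨c i, hcW i⟩), rfl⟩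

end Coordinates

/-! ### §2 `D(𝟙_m) = (E^m ⊗_{ℚ_p} B)^Γ = E^m ⊗_{ℚ_p} B^Γ` and its `E`-dimension -/

section Abstract

variable {p : ℕ} [Fact p.Prime] {E : Type*} [Field E] [Algebra ℚ_[p] E]
  {Γ : Type*} {B : Type*} [CommRing B] [Algebra ℚ_[p] B] {m : ℕ}

/-- For the trivial `ρ` the diagonal action of `σ` on `E^m ⊗_{ℚ_p} B` is `1 ⊗ σ_B`. [folklore] -/
theorem diagAct_eq_lTensor_of_trivial {ρ : Γ → GL (Fin m) E} (hρ : ∀ σ, ρ σ = 1) (gal : Γ → (B →ₐ[ℚ_[p]] B))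
    (σ : Γ) (x : (Fin m → E) ⊗[ℚ_[p]] B) :
    diagAct ρ gal σ x = (gal σ).toLinearMap.lTensor (Fin m → E) x := by
  have h : (diagAct ρ gal σ).restrictScalars ℚ_[p] = (gal σ).toLinearMap.lTensor (Fin m → E) :=
    TensorProduct.ext' fun v b => by
      simp only [LinearMap.restrictScalars_apply, diagAct, TensorProduct.AlgebraTensorModule.map_tmul, hρ σ,
        Units.val_one, Matrix.toLin'_one, LinearMap.id_apply, AlgHom.toLinearMap_apply, LinearMap.lTensor_tmul]
  exact LinearMap.congr_fun h x

/-- **`e_k ⊗ w ∈ D(𝟙_m)` for `w ∈ B^Γ`.** [cite: FontaineAsterisque223III, Exp. III §1.5] -/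
theorem single_tmul_mem_invariants_of_trivial {ρ : Γ → GL (Fin m) E} (hρ : ∀ σ, ρ σ = 1)
    (gal : Γ → (B →ₐ[ℚ_[p]] B)) (k : Fin m) (w : fixedSubalgebra gal) :
    (Pi.single k (1 : E) : Fin m → E) ⊗ₜ[ℚ_[p]] (w : B) ∈ invariants ρ gal := by
  intro σ
  rw [diagAct_eq_lTensor_of_trivial hρ, LinearMap.lTensor_tmul, AlgHom.toLinearMap_apply, gal_coe_fixedSubalgebra]

/-- A pure tensor `v ⊗ b` is the `E`-combination `∑_k v_k • (e_k ⊗ b)`. [folklore] -/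
theorem tmul_eq_sum_smul_single_tmul (v : Fin m → E) (b : B) :
    v ⊗ₜ[ℚ_[p]] b = ∑ k, v k • ((Pi.single k (1 : E) : Fin m → E) ⊗ₜ[ℚ_[p]] b) := by
  conv_lhs => rw [← (Pi.basisFun E (Fin m)).sum_repr v]
  rw [TensorProduct.sum_tmul]
  refine Finset.sum_congr rfl fun k _ => ?_
  rw [Pi.basisFun_repr, Pi.basisFun_apply, TensorProduct.smul_tmul']

/-- **`D(𝟙_m) ⊆ E-span {e_k ⊗ w : w ∈ B^Γ}`** (§1 with `K = ℚ_p`, `V = E^m`, then `v ⊗ w = ∑ v_k • (e_k ⊗ w)`).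
[cite: FontaineAsterisque223III, Exp. III §1.5] -/
theorem invariants_le_span_of_trivial {ρ : Γ → GL (Fin m) E} (hρ : ∀ σ, ρ σ = 1) (gal : Γ → (B →ₐ[ℚ_[p]] B)) :
    invariants ρ gal ≤ Submodule.span E
      (Set.range fun kw : Fin m × fixedSubalgebra gal => (Pi.single kw.1 (1 : E) : Fin m → E) ⊗ₜ[ℚ_[p]] (kw.2 : B)) := by
  intro x hx
  have hx' : x ∈ Submodule.span ℚ_[p]
      (Set.range fun vn : (Fin m → E) × (fixedSubalgebra gal : Set B) => vn.1 ⊗ₜ[ℚ_[p]] (vn.2 : B)) :=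
    mem_span_tmul_of_forall_lTensor_eq (fun σ => (gal σ).toLinearMap) (fixedSubalgebra gal : Set B)
      (fun n hn => hn) fun σ => by rw [← diagAct_eq_lTensor_of_trivial hρ gal σ x]; exact hx σ
  have hle : Submodule.span ℚ_[p]
      (Set.range fun vn : (Fin m → E) × (fixedSubalgebra gal : Set B) => vn.1 ⊗ₜ[ℚ_[p]] (vn.2 : B)) ≤
      (Submodule.span E (Set.range fun kw : Fin m × fixedSubalgebra gal =>
        (Pi.single kw.1 (1 : E) : Fin m → E) ⊗ₜ[ℚ_[p]] (kw.2 : B))).restrictScalars ℚ_[p] := by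
    refine Submodule.span_le.2 ?_
    rintro _ ⟨⟨v, n⟩, rfl⟩
    change v ⊗ₜ[ℚ_[p]] (n : B) ∈ Submodule.span E (Set.range fun kw : Fin m × fixedSubalgebra gal =>
      (Pi.single kw.1 (1 : E) : Fin m → E) ⊗ₜ[ℚ_[p]] (kw.2 : B))
    rw [tmul_eq_sum_smul_single_tmul]
    exact Submodule.sum_mem _ fun k _ =>
      Submodule.smul_mem _ _ (Submodule.subset_span ⟨(k, ⟨(n : B), n.2⟩), rfl⟩)
  exact hle hx'

/-- ★ **`D(𝟙_m) = E-span {e_k ⊗ w : w ∈ B^Γ}`**, i.e. `(E^m ⊗_{ℚ_p} B)^Γ = E^m ⊗_{ℚ_p} B^Γ`.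
[cite: FontaineAsterisque223III, Exp. III §1.5] -/
theorem invariants_eq_span_of_trivial {ρ : Γ → GL (Fin m) E} (hρ : ∀ σ, ρ σ = 1) (gal : Γ → (B →ₐ[ℚ_[p]] B)) :
    invariants ρ gal = Submodule.span E
      (Set.range fun kw : Fin m × fixedSubalgebra gal => (Pi.single kw.1 (1 : E) : Fin m → E) ⊗ₜ[ℚ_[p]] (kw.2 : B)) :=
  le_antisymm (invariants_le_span_of_trivial hρ gal) <| Submodule.span_le.2 <| by
    rintro _ ⟨kw, rfl⟩
    exact single_tmul_mem_invariants_of_trivial hρ gal kw.1 kw.2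

/-- **`D(𝟙_m) ⊆ E-span {e_k ⊗ w_j}`** for any family `(w_j)` spanning `B^Γ` over `ℚ_p`. [cite: FontaineAsterisque223III, Exp. III §1.5] -/
theorem invariants_le_span_range_of_trivial {ρ : Γ → GL (Fin m) E} (hρ : ∀ σ, ρ σ = 1)
    (gal : Γ → (B →ₐ[ℚ_[p]] B)) {ι : Type*} (w : ι → fixedSubalgebra gal)
    (hw : ⊤ ≤ Submodule.span ℚ_[p] (Set.range w)) :
    invariants ρ gal ≤ Submodule.span E
      (Set.range fun kj : Fin m × ι => (Pi.single kj.1 (1 : E) : Fin m → E) ⊗ₜ[ℚ_[p]] (w kj.2 : B)) := by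
  refine (invariants_le_span_of_trivial hρ gal).trans (Submodule.span_le.2 ?_)
  rintro _ ⟨⟨k, u⟩, rfl⟩
  -- `u ∈ span_{ℚ_p} (w_j)` ⇒ `e_k ⊗ u ∈ span_{ℚ_p} (e_k ⊗ w_j) ⊆ span_E (e_k ⊗ w_j)`
  let T : fixedSubalgebra gal →ₗ[ℚ_[p]] (Fin m → E) ⊗[ℚ_[p]] B :=
    (TensorProduct.mk ℚ_[p] (Fin m → E) B (Pi.single k 1)) ∘ₗ (fixedSubalgebra gal).val.toLinearMap
  have hT : ∀ u : fixedSubalgebra gal, T u = (Pi.single k (1 : E) : Fin m → E) ⊗ₜ[ℚ_[p]] (u : B) := fun u => rfl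
  have hu : T u ∈ Submodule.span ℚ_[p] (T '' Set.range w) :=
    Submodule.apply_mem_span_image_of_mem_span T (hw Submodule.mem_top)
  have hle : Submodule.span ℚ_[p] (T '' Set.range w) ≤
      (Submodule.span E (Set.range fun kj : Fin m × ι =>
        (Pi.single kj.1 (1 : E) : Fin m → E) ⊗ₜ[ℚ_[p]] (w kj.2 : B))).restrictScalars ℚ_[p] := by
    refine Submodule.span_le.2 ?_
    rintro _ ⟨_, ⟨j, rfl⟩, rfl⟩
    change T (w j) ∈ Submodule.span E (Set.range fun kj : Fin m × ι =>
      (Pi.single kj.1 (1 : E) : Fin m → E) ⊗ₜ[ℚ_[p]] (w kj.2 : B))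
    rw [hT]
    exact Submodule.subset_span ⟨(k, j), rfl⟩
  have h := hle hu
  rw [hT] at h
  exact h

/-- The family `e_k ⊗ w_j` in `D(𝟙_m)` for the `ℚ_p`-basis `(w_j) = Module.finBasis` of a finite-dimensional `B^Γ`.
[folklore] -/
def basisVector {ρ : Γ → GL (Fin m) E} (hρ : ∀ σ, ρ σ = 1) (gal : Γ → (B →ₐ[ℚ_[p]] B))
    [Module.Finite ℚ_[p] (fixedSubalgebra gal)]
    (kj : Fin m × Fin (Module.finrank ℚ_[p] (fixedSubalgebra gal))) : invariants ρ gal :=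
  ⟨(Pi.single kj.1 (1 : E) : Fin m → E) ⊗ₜ[ℚ_[p]]
      ((Module.finBasis ℚ_[p] (fixedSubalgebra gal) kj.2 : fixedSubalgebra gal) : B),
    single_tmul_mem_invariants_of_trivial hρ gal kj.1 _⟩

/-- Underlying tensor of `basisVector`. [folklore] -/
theorem coe_basisVector {ρ : Γ → GL (Fin m) E} (hρ : ∀ σ, ρ σ = 1) (gal : Γ → (B →ₐ[ℚ_[p]] B))
    [Module.Finite ℚ_[p] (fixedSubalgebra gal)] (kj : Fin m × Fin (Module.finrank ℚ_[p] (fixedSubalgebra gal))) :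
    ((basisVector hρ gal kj : invariants ρ gal) : (Fin m → E) ⊗[ℚ_[p]] B) =
      (Pi.single kj.1 (1 : E) : Fin m → E) ⊗ₜ[ℚ_[p]]
        ((Module.finBasis ℚ_[p] (fixedSubalgebra gal) kj.2 : fixedSubalgebra gal) : B) := rfl

/-- The `e_k ⊗ w_j` are `E`-linearly independent (tree `linearIndependent_single_tmul`: the `w_j` are
`ℚ_p`-independent in `B`). [folklore] -/
theorem linearIndependent_basisVector {ρ : Γ → GL (Fin m) E} (hρ : ∀ σ, ρ σ = 1) (gal : Γ → (B →ₐ[ℚ_[p]] B))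
    [Module.Finite ℚ_[p] (fixedSubalgebra gal)] : LinearIndependent E (basisVector hρ gal) := by
  have hw : LinearIndependent ℚ_[p]
      fun j : Fin (Module.finrank ℚ_[p] (fixedSubalgebra gal)) =>
        ((Module.finBasis ℚ_[p] (fixedSubalgebra gal) j : fixedSubalgebra gal) : B) := by
    have h := (Module.finBasis ℚ_[p] (fixedSubalgebra gal)).linearIndependent.map'
      (fixedSubalgebra gal).val.toLinearMap (LinearMap.ker_eq_bot.2 fun a b hab => Subtype.ext hab)
    exact h
  have h := linearIndependent_single_tmul (E := E) (m := m) hw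
  have e : ((invariants ρ gal).subtype ∘ basisVector hρ gal) =
      fun kj : Fin m × Fin (Module.finrank ℚ_[p] (fixedSubalgebra gal)) =>
        (Pi.single kj.1 (1 : E) : Fin m → E) ⊗ₜ[ℚ_[p]]
          ((Module.finBasis ℚ_[p] (fixedSubalgebra gal) kj.2 : fixedSubalgebra gal) : B) :=
    funext fun _ => rfl
  apply LinearIndependent.of_comp (invariants ρ gal).subtype
  rw [e]
  exact h

/-- The `e_k ⊗ w_j` span `D(𝟙_m)` over `E`. [folklore] -/
theorem top_le_span_basisVector {ρ : Γ → GL (Fin m) E} (hρ : ∀ σ, ρ σ = 1) (gal : Γ → (B →ₐ[ℚ_[p]] B))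
    [Module.Finite ℚ_[p] (fixedSubalgebra gal)] : ⊤ ≤ Submodule.span E (Set.range (basisVector hρ gal)) := by
  intro x _
  have hx := invariants_le_span_range_of_trivial hρ gal
    (fun j => (Module.finBasis ℚ_[p] (fixedSubalgebra gal) j : fixedSubalgebra gal))
    (Module.finBasis ℚ_[p] (fixedSubalgebra gal)).span_eq.ge x.2
  have e : (fun kj : Fin m × Fin (Module.finrank ℚ_[p] (fixedSubalgebra gal)) =>
        (Pi.single kj.1 (1 : E) : Fin m → E) ⊗ₜ[ℚ_[p]]
          ((Module.finBasis ℚ_[p] (fixedSubalgebra gal) kj.2 : fixedSubalgebra gal) : B)) =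
      (invariants ρ gal).subtype ∘ basisVector hρ gal :=
    funext fun _ => rfl
  rw [e, Set.range_comp, Submodule.span_image] at hx
  obtain ⟨y, hy, hyx⟩ := Submodule.mem_map.1 hx
  have hyx' : y = x := Subtype.ext hyx
  rw [← hyx']
  exact hy

/-- **The `E`-basis `(e_k ⊗ w_j)` of `D(𝟙_m)`**, indexed by `Fin m × Fin (dim_{ℚ_p} B^Γ)`. [cite: FontaineAsterisque223III, Exp. III §1.5] -/
def invariantsBasisOfTrivial {ρ : Γ → GL (Fin m) E} (hρ : ∀ σ, ρ σ = 1) (gal : Γ → (B →ₐ[ℚ_[p]] B))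
    [Module.Finite ℚ_[p] (fixedSubalgebra gal)] :
    Module.Basis (Fin m × Fin (Module.finrank ℚ_[p] (fixedSubalgebra gal))) E (invariants ρ gal) :=
  Module.Basis.mk (linearIndependent_basisVector hρ gal) (top_le_span_basisVector hρ gal)

/-- ★ **`D(𝟙_m)` is finite-dimensional over `E`** when `B^Γ` is finite-dimensional over `ℚ_p`.
[cite: FontaineAsterisque223III, Exp. III §1.5] -/
theorem finite_invariants_of_trivial {ρ : Γ → GL (Fin m) E} (hρ : ∀ σ, ρ σ = 1) (gal : Γ → (B →ₐ[ℚ_[p]] B))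
    [Module.Finite ℚ_[p] (fixedSubalgebra gal)] : Module.Finite E (invariants ρ gal) :=
  Module.Finite.of_basis (invariantsBasisOfTrivial hρ gal)

/-- ★ **`dim_E D(𝟙_m) = m · dim_{ℚ_p} B^Γ`.** [cite: FontaineAsterisque223III, Exp. III §1.5] -/
theorem finrank_invariants_of_trivial {ρ : Γ → GL (Fin m) E} (hρ : ∀ σ, ρ σ = 1) (gal : Γ → (B →ₐ[ℚ_[p]] B))
    [Module.Finite ℚ_[p] (fixedSubalgebra gal)] :
    Module.finrank E (invariants ρ gal) = m * Module.finrank ℚ_[p] (fixedSubalgebra gal) := by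
  rw [Module.finrank_eq_card_basis (invariantsBasisOfTrivial hρ gal), Fintype.card_prod, Fintype.card_fin,
    Fintype.card_fin]

end Abstract

/-! ### §3 `B = B_max(F)`: `D_cris(𝟙_m)` is finite-dimensional of dimension `m · dim_{ℚ_p} B_max(F)^{Γ_F}` -/

section Bmax

variable {F : Type} [Field F] [ValuativeRel F] [TopologicalSpace F] [IsNonarchimedeanLocalField F]
  [CharZero F] {p : ℕ} [Fact p.Prime] [Fact (¬ IsUnit (p : maxUnramifiedCompletion F))]
  [CharP (IsLocalRing.ResidueField (maxUnramifiedCompletion F)) p] [Fact (¬ IsUnit (p : integerC F))]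
  [IsAdicComplete (Ideal.span {(p : integerC F)}) (integerC F)] {m : ℕ}

omit [Fact (¬ IsUnit (p : maxUnramifiedCompletion F))] [CharP (IsLocalRing.ResidueField (maxUnramifiedCompletion F)) p] in
/-- ★ **`D_cris(𝟙_m)` over the constructed `B_max(F)` is finite-dimensional over `ℚ̄_p`** as soon as
`B_max(F)^{Γ_F}` is finite-dimensional over `ℚ_p`. [cite: FontaineAsterisque223III, Exp. III §1.5] -/
theorem finite_Dcris_one [Module.Finite ℚ_[p] (fixedSubalgebra (galBmaxAlgHom (F := F) (p := p)))] :
    Module.Finite (PadicAlgCl p) (Dcris (F := F) (p := p) (1 : FramedRep (absoluteGaloisGroup F) (PadicAlgCl p) m)) :=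
  finite_invariants_of_trivial (ρ := ⇑(1 : FramedRep (absoluteGaloisGroup F) (PadicAlgCl p) m)) (fun _ => rfl)
    (galBmaxAlgHom (F := F) (p := p))

omit [Fact (¬ IsUnit (p : maxUnramifiedCompletion F))] [CharP (IsLocalRing.ResidueField (maxUnramifiedCompletion F)) p] in
/-- ★ **`dim_{ℚ̄_p} D_cris(𝟙_m) = m · dim_{ℚ_p} B_max(F)^{Γ_F}`** (when the latter is finite).
[cite: FontaineAsterisque223III, Exp. III §1.5] -/
theorem finrank_Dcris_one_eq [Module.Finite ℚ_[p] (fixedSubalgebra (galBmaxAlgHom (F := F) (p := p)))] :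
    Module.finrank (PadicAlgCl p) (Dcris (F := F) (p := p) (1 : FramedRep (absoluteGaloisGroup F) (PadicAlgCl p) m)) =
      m * Module.finrank ℚ_[p] (fixedSubalgebra (galBmaxAlgHom (F := F) (p := p))) :=
  finrank_invariants_of_trivial (ρ := ⇑(1 : FramedRep (absoluteGaloisGroup F) (PadicAlgCl p) m)) (fun _ => rfl)
    (galBmaxAlgHom (F := F) (p := p))

/-- ★ **`f ≤ dim_{ℚ_p} B_max(F)^{Γ_F}`** for `q_F = p^f` and `θ` surjective: the Teichmüller periods of lifts of an
`𝔽_p`-basis of `k_F` are `ℚ_p`-independent invariants (tree `linearIndependent_teichBmax`).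
[cite: FontaineAsterisque223III, Exp. II §2.3] -/
theorem le_finrank_fixedSubalgebra (hF : Function.Surjective (fontaineTheta (integerC F) p)) {f : ℕ}
    (hq : residueFieldCard F = p ^ f) [Module.Finite ℚ_[p] (fixedSubalgebra (galBmaxAlgHom (F := F) (p := p)))] :
    f ≤ Module.finrank ℚ_[p] (fixedSubalgebra (galBmaxAlgHom (F := F) (p := p))) := by
  obtain ⟨a, ha⟩ := exists_residue_independent (F := F) p hq
  have hli : LinearIndependent ℚ_[p] fun j => teichPeriod F p (a j) := by
    apply LinearIndependent.of_comp (fixedSubalgebra (galBmaxAlgHom (F := F) (p := p))).val.toLinearMap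
    have e : ((fixedSubalgebra (galBmaxAlgHom (F := F) (p := p))).val.toLinearMap ∘ fun j => teichPeriod F p (a j)) =
        fun j => teichBmax (F := F) (p := p) (a j) := funext fun _ => rfl
    rw [e]
    exact linearIndependent_teichBmax hF ha
  simpa using hli.fintype_card_le_finrank

/-- **`m · f ≤ dim_{ℚ̄_p} D_cris(𝟙_m) = m · dim_{ℚ_p} B_max(F)^{Γ_F}`**: the tree's lower bound
`mul_le_finrank_Dcris_one` with its finiteness instance DISCHARGED by `finite_Dcris_one`.
[cite: BuzzardGeeLMS2014, Conj. 3.2.2] [cite: FontaineAsterisque223III, Exp. III §1.5] -/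
theorem mul_le_finrank_Dcris_one_of_finite (hF : Function.Surjective (fontaineTheta (integerC F) p)) {f : ℕ}
    (hq : residueFieldCard F = p ^ f) [Module.Finite ℚ_[p] (fixedSubalgebra (galBmaxAlgHom (F := F) (p := p)))] :
    m * f ≤ Module.finrank (PadicAlgCl p)
      (Dcris (F := F) (p := p) (1 : FramedRep (absoluteGaloisGroup F) (PadicAlgCl p) m)) := by
  rw [finrank_Dcris_one_eq]
  exact Nat.mul_le_mul_left m (le_finrank_fixedSubalgebra hF hq)

end Bmax

end D2Cris

end Summit.Langlands.Langlands.Theorems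

end
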